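import Summits.ResolutionOfSingularities.ResolutionOfSingularities.Theorems.HilbertSamuelEliminationCampaignW42ToricMarkedVectors
import Mathlib.Algebra.Module.Basic
import Mathlib.Algebra.Module.Pi

/-!
# [OURS · L1 W4.2] Toric marked monomial objects in dimension 3 — brick 7D: THE FAN PROPERTY (foundations of bridge B2)

[OURS · L1 W4.2 · seat res-L1-s42-pv-2 gen 5] Memo `L/res-L1-s42-pv-2/CALIBRATION-W42-O2-v4.md` §4/§7 (B2).  `IdeasL1Idea2R8.HStage` names rays by
their VECTORS; transferring legality from the id-model needs «equal vectors ⇒ same ray».  This file defines the FAN PROPERTY of a vector state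
(`IsFan`: every cone's vectors are linearly independent over `ℚ`, and the cones spanned by two cones meet in the cone spanned by their COMMON rays),
proves that it makes the vector naming faithful (`IsFan.vec_injective`) and that the initial state of a position is a fan (`isFan_ofPosition`).
The preservation of `IsFan` under the blow-up of a legal face (star subdivision of a fan is a fan — four coefficient computations in a unimodular
basis, written out in the memo §7) is the remaining step of bridge B2 and is NOT here.  NOT a statement of the manuscript under review.  AI work,
weaker than expert review.  No `sorry`, no new axiom.
-/

set_option linter.dupNamespace false -- mandated namespace of this single-conjunct summit

namespace Summit.ResolutionOfSingularities.ResolutionOfSingularities.Theorems.CampaignW42.Toric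

open Finset

namespace Fan

/-- The ray vector of id `r` as a rational vector. -/
def qv (V : ℕ → Fin 3 → ℤ) (r : ℕ) : Fin 3 → ℚ := fun i => (V r i : ℚ)

/-- **[OURS · L1 W4.2]** `p` lies in the closed cone spanned by the vectors of the id-set `C`. -/
def InCone (V : ℕ → Fin 3 → ℤ) (C : Finset ℕ) (p : Fin 3 → ℚ) : Prop :=
  ∃ c : ℕ → ℚ, (∀ r ∈ C, 0 ≤ c r) ∧ p = ∑ r ∈ C, c r • qv V r

/-- **[OURS · L1 W4.2]** The vectors of the id-set `C` are linearly independent (over `ℚ`). -/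
def Indep (V : ℕ → Fin 3 → ℤ) (C : Finset ℕ) : Prop :=
  ∀ c : ℕ → ℚ, ∑ r ∈ C, c r • qv V r = 0 → ∀ r ∈ C, c r = 0

/-- Uniqueness of coefficients on an independent id-set. -/
theorem Indep.coeff_unique {V : ℕ → Fin 3 → ℤ} {C : Finset ℕ} (h : Indep V C) {a b : ℕ → ℚ}
    (hab : ∑ r ∈ C, a r • qv V r = ∑ r ∈ C, b r • qv V r) : ∀ r ∈ C, a r = b r := by
  intro r hr
  have h0 : ∑ y ∈ C, (a y - b y) • qv V y = 0 := by
    simp_rw [sub_smul]; rw [Finset.sum_sub_distrib, hab, sub_self]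
  have := h (fun y => a y - b y) h0 r hr
  simpa [sub_eq_zero] using this

/-- A single ray lies in the cone of any id-set containing it. -/
theorem inCone_single {V : ℕ → Fin 3 → ℤ} {C : Finset ℕ} {r : ℕ} (hr : r ∈ C) : InCone V C (qv V r) := by
  classical
  refine ⟨fun y => if y = r then 1 else 0, fun y _ => by dsimp only; split_ifs <;> norm_num, ?_⟩
  rw [Finset.sum_eq_single r]
  · dsimp only; rw [if_pos rfl, one_smul]
  · intro y _ hy; dsimp only; rw [if_neg hy, zero_smul]
  · intro h; exact absurd hr h

end Fan

namespace VState

open Fan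

variable {ι : Type}

/-- **[OURS · L1 W4.2]** THE FAN PROPERTY of a vector state: every cone's vectors are independent, and the cones of any two cones meet in the
cone of their common rays (the intersection of two cones of a fan is their common face). -/
def IsFan (s : VState ι) : Prop :=
  (∀ C ∈ s.cones, Indep s.vec C) ∧
  ∀ C ∈ s.cones, ∀ C' ∈ s.cones, ∀ p, InCone s.vec C p → InCone s.vec C' p → InCone s.vec (C ∩ C') p

/-- **Equal vectors ⇒ same ray** in a fan state: the vector naming of `HStage` is faithful on reachable fans (the fact bridge B2 needs). -/
theorem IsFan.vec_injective {s : VState ι} (h : s.IsFan) {C C' : Finset ℕ} (hC : C ∈ s.cones) (hC' : C' ∈ s.cones) {r r' : ℕ}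
    (hr : r ∈ C) (hr' : r' ∈ C') (heq : s.vec r = s.vec r') : r = r' := by
  classical
  have hq : qv s.vec r = qv s.vec r' := by funext i; simp [qv, heq]
  -- r lies in C ∩ C'
  have hp : InCone s.vec (C ∩ C') (qv s.vec r) :=
    h.2 C hC C' hC' _ (inCone_single hr) (hq ▸ inCone_single hr')
  obtain ⟨c, hc0, hcp⟩ := hp
  -- compare the two expansions of `qv r` on the basis C
  have hexp : ∑ y ∈ C, (if y = r then (1 : ℚ) else 0) • qv s.vec y = ∑ y ∈ C, (if y ∈ C' then c y else 0) • qv s.vec y := by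
    rw [Finset.sum_eq_single r (fun y _ hy => by rw [if_neg hy, zero_smul]) (fun h => absurd hr h)]
    rw [if_pos rfl, one_smul, hcp]
    have h1 : ∑ y ∈ C, (if y ∈ C' then c y else 0) • qv s.vec y = ∑ y ∈ C, (if y ∈ C' then c y • qv s.vec y else 0) :=
      Finset.sum_congr rfl (fun y _ => by split_ifs <;> simp)
    rw [h1, ← Finset.sum_filter, Finset.filter_mem_eq_inter]
  have hrr := (h.1 C hC).coeff_unique hexp r hr
  rw [if_pos rfl] at hrr
  have hrC' : r ∈ C' := by
    by_contra hn; rw [if_neg hn] at hrr; exact one_ne_zero hrr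
  -- now r, r' ∈ C' with equal vectors: independence of C'
  by_contra hne
  have hsum : ∑ y ∈ C', (if y = r then (1 : ℚ) else if y = r' then -1 else 0) • qv s.vec y = 0 := by
    rw [Finset.sum_eq_add_of_mem r r' hrC' hr' hne (fun y _ hy => by rw [if_neg hy.1, if_neg hy.2, zero_smul])]
    rw [if_pos rfl, if_neg (Ne.symm hne), if_pos rfl, hq]
    simp
  have := h.1 C' hC' _ hsum r hrC'
  rw [if_pos rfl] at this
  exact one_ne_zero this

/-- The initial state of a position is a fan (a single cone on the standard basis). -/
theorem isFan_ofPosition (A : Finset (Fin 3 → ℚ)) (m : ℕ) (hm : ∀ v ∈ A, ∀ k : Fin 3, ∃ z : ℤ, (v k) * m = z) :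
    (ofPosition A m hm).IsFan := by
  classical
  have hcones : (ofPosition A m hm).cones = {{0, 1, 2}} := rfl
  have hvec : ∀ r : ℕ, ∀ i : Fin 3, (ofPosition A m hm).vec r i = if h : r < 3 then (if (⟨r, h⟩ : Fin 3) = i then 1 else 0) else 0 :=
    fun _ _ => rfl
  constructor
  · intro C hC
    rw [hcones, Finset.mem_singleton] at hC
    subst hC
    intro c hc r hr
    -- evaluate the vanishing sum at the coordinate `r`
    have hr3 : r < 3 := by simp only [Finset.mem_insert, Finset.mem_singleton] at hr; omega
    have h := congrFun hc ⟨r, hr3⟩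
    simp only [Finset.sum_apply, Pi.smul_apply, smul_eq_mul, qv, Pi.zero_apply] at h
    rw [Finset.sum_eq_single r] at h
    · rw [hvec] at h; simp [hr3] at h; exact h
    · intro y hy hyr
      have hy3 : y < 3 := by simp only [Finset.mem_insert, Finset.mem_singleton] at hy; omega
      rw [hvec]; simp only [hy3, dif_pos]
      rw [if_neg (fun h' => hyr (by have := congrArg Fin.val h'; simpa using this))]
      simp
    · intro h'; exact absurd hr h'
  · intro C hC C' hC' p hp _
    rw [hcones, Finset.mem_singleton] at hC hC'
    subst hC; subst hC'
    rw [Finset.inter_self]; exact hp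

end VState

end Summit.ResolutionOfSingularities.ResolutionOfSingularities.Theorems.CampaignW42.Toric
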